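import Literature.Computability.AlgebraicComplexity.MS21IndependentMapLemmas
import Literature.Computability.AlgebraicComplexity.MS21ANFInterpolatingSetExistence
import HarnessLib

/-!
# Medini–Shpilka 2021: `k`-independent maps hit every polynomial with a monomial on `≤ k`
# variables (coordinate projections), and the slice `max{Δ₁, Δ₂} ≤ 3` of Thm 35

Theorem-only companion of `MS21DenseOrbitsHittingSets.lean` (cell `val-lit`, seat x5 g3; registry
claim `MS2021_thm_35`, partial by design). Source: D. Medini, A. Shpilka, *Hitting sets and
reconstruction for dense orbits in VP_e and ΣΠΣ circuits*, CCC 2021 (LIPIcs 200:19) =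
arXiv:2102.05632.

* **Coordinate projections from `k`-independent maps** (Def 19 = arXiv ‹Def 1.15›, and the
  mechanism of Obs 3.1 (1)–(2), arXiv p0017:L7–L9): by the defining property of a `1`-independent
  block — "there exists an assignment `a_i` to `y` such that the `i`th coordinate of `G(a_i, z_1)`
  is `z_1`, and the rest of the coordinates are `0`" — substituting, block by block, `y := a_{i_l}`
  and `z_l := P_l` turns a `k`-independent `G` into `x_j ↦ Σ_{l : i_l = j} P_l`
  (`IsIndependent.exists_aeval_eq_sum_ite`); with the targets `P_l = x_{i_l}` on an injective
  labelling of a set `S` of `≤ k` coordinates (and `P_l = 0` on the unused blocks) this is the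
  coordinate projection `x_j ↦ [j ∈ S] x_j` (`IsIndependent.exists_aeval_eq_proj`).
* **Support lemma** (`IsIndependent.bind₁_ne_zero_of_mem_support`): if `f` has a nonzero
  coefficient at a monomial `x^μ` involving at most `k` variables, then `f ∘ G ≠ 0` for EVERY
  `k`-independent `G` over any commutative semiring — the projection onto `var(x^μ)` keeps exactly
  the monomials supported inside `var(x^μ)` (private `coeff_aeval_proj`), among them `x^μ`. In particular
  (`IsIndependent.bind₁_ne_zero_of_totalDegree_le`) every nonzero `f` with `deg f ≤ k` is hit by
  every `k`-independent map. (This is the `k`-fold coordinate special case of the paper's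
  projection Lemma 3.10; it is not a numbered statement of the source and is labelled as such.)
* **`MS2021_thm_35_of_max_le_three`** — the slice `max{Δ₁, Δ₂} ≤ 3` of the typed fact
  `MS2021_thm_35` (MS Thm 35 = arXiv ‹pitSumOfRoanfThm›, p0008:L29–30: "`f = f_1 - f_2 ≠ 0`,
  `f_i ∈ ANF_{Δ_i}^{GLaff_n(F)}`, `k = 2 max{Δ_1, Δ_2} + 7` ⇒ `f ∘ G ≠ 0` for any uniform
  `k`-independent `G`"), for EVERY field and without using uniformity: `deg f ≤ 2^{max Δ_i} ≤ 8 ≤ k`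
  when `max Δ_i ≤ 3` (`MS2021.Cor36.totalDegree_anf_le`, `MS2021.totalDegree_affSubst_le`), so the
  support lemma applies. ROUTE ≠ PRINT (disclosed): the printed proof (§5.2, arXiv p0026–p0031)
  goes through the structure of ANF formulas and second-order derivatives for every `Δ`; the
  slice here covers exactly the ANFs on `≤ 64` leaves, where the degree is below the independence.

No definitions, no new named facts (D-0026). HONEST FRAMING: a partial result toward a typed
literature statement; `VP ≠ VNP` is NOT proved and nothing here bears on it.

## References
* [MediniShpilka2021] D. Medini, A. Shpilka, CCC 2021, LIPIcs 200:19 = arXiv:2102.05632: Def 19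
  (CCC p.19:9; arXiv ‹Def 1.15› p0006:L64–67), Obs 3.1 (arXiv p0017:L5–L9), Lemma 3.10
  (p0018:L17–L40), Thm 35 (CCC p.19:13; arXiv p0008:L29–30), Def 8 (`ANF_Δ`, CCC p.19:7).
-/

noncomputable section

open MvPolynomial

namespace Literature.Computability.AlgebraicComplexity

namespace MS2021

/-! ### Block substitutions with arbitrary targets -/

section Blocks

variable {K : Type*} [CommSemiring K] {n t : ℕ} {τ : Type*}

/-- A `1`-independent block can be specialised so that `G_j ↦ δ_{ij} · P` for ANY target polynomial
`P` (Def 19's assignment `a_i` on the control variables, `z ↦ P`).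
[cite: MediniShpilka2021, Def 19 (CCC p.19:9; arXiv ‹Def 1.15› p0006:L64-65)] -/
theorem IsOneIndependent.exists_aeval_eq_ite {G : Fin n → MvPolynomial (Fin t ⊕ Unit) K}
    (hG : IsOneIndependent G) (i : Fin n) (P : MvPolynomial τ K) :
    ∃ ψ : Fin t ⊕ Unit → MvPolynomial τ K, ∀ j, aeval ψ (G j) = if j = i then P else 0 := by
  obtain ⟨a, ha⟩ := hG i
  refine ⟨Sum.elim (fun s => C (a s)) (fun _ => P), fun j => ?_⟩
  have hcomp : (Sum.elim (fun s => C (a s)) (fun _ => P) : Fin t ⊕ Unit → MvPolynomial τ K) =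
      fun v => aeval (fun _ : Unit => P)
        (Sum.elim (fun s => C (a s)) (fun _ => X ()) v : MvPolynomial Unit K) := by
    funext v
    rcases v with s | u
    · simp
    · simp
  rw [hcomp, ← comp_aeval, AlgHom.comp_apply, ha j]
  split_ifs <;> simp

/-- **Block substitution of a `k`-independent map with prescribed targets**: for any choice of a
coordinate `ι l` and a target `P l` per block, some substitution of all the variables sends
`G_j ↦ Σ_{l : ι l = j} P l`. [cite: MediniShpilka2021, Def 19 and Obs 3.1 (1)–(2) (arXiv p0017:L7-L9)] -/
theorem IsIndependent.exists_aeval_eq_sum_ite {k : ℕ}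
    {G : Fin n → MvPolynomial (Fin k × (Fin t ⊕ Unit)) K} (hG : IsIndependent k G)
    (ι : Fin k → Fin n) (P : Fin k → MvPolynomial τ K) :
    ∃ φ : Fin k × (Fin t ⊕ Unit) → MvPolynomial τ K,
      ∀ j, aeval φ (G j) = ∑ l, if j = ι l then P l else 0 := by
  obtain ⟨Gs, hGs, hG⟩ := hG
  choose ψ hψ using fun l => (hGs l).exists_aeval_eq_ite (ι l) (P l)
  refine ⟨fun p => ψ p.1 p.2, fun j => ?_⟩
  rw [hG j, map_sum]
  refine Finset.sum_congr rfl fun l _ => ?_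
  rw [aeval_rename]
  exact hψ l j

/-- **Coordinate projection from a `k`-independent map**: for every set `S` of at most `k`
coordinates (and `n ≥ 1`), some substitution of the variables of a `k`-independent `G` sends
`G_j ↦ x_j` for `j ∈ S` and `G_j ↦ 0` otherwise. [cite: MediniShpilka2021, Def 19 and Obs 3.1 (arXiv p0017:L7-L9); cf. Lemma 3.10 (p0018:L17-L40)] -/
theorem IsIndependent.exists_aeval_eq_proj {k : ℕ}
    {G : Fin n → MvPolynomial (Fin k × (Fin t ⊕ Unit)) K} (hG : IsIndependent k G)
    (S : Finset (Fin n)) (hS : S.card ≤ k) (j₀ : Fin n) :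
    ∃ φ : Fin k × (Fin t ⊕ Unit) → MvPolynomial (Fin n) K,
      ∀ j, aeval φ (G j) = if j ∈ S then X j else 0 := by
  classical
  -- an embedding of `S` into the blocks
  have hcard : Fintype.card S ≤ Fintype.card (Fin k) := by simpa using hS
  obtain ⟨e⟩ := Function.Embedding.nonempty_of_card_le hcard
  -- block labelling: block `e s` isolates the coordinate `s` with target `x_s`; other blocks die
  let ι : Fin k → Fin n := fun l => if h : ∃ s : S, e s = l then (h.choose : Fin n) else j₀
  let P : Fin k → MvPolynomial (Fin n) K := fun l => if ∃ s : S, e s = l then X (ι l) else 0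
  have hι : ∀ s : S, ι (e s) = s := by
    intro s
    have h : ∃ s' : S, e s' = e s := ⟨s, rfl⟩
    have h1 : ι (e s) = (h.choose : Fin n) := dif_pos h
    rw [h1, e.injective h.choose_spec]
  obtain ⟨φ, hφ⟩ := hG.exists_aeval_eq_sum_ite ι P
  refine ⟨φ, fun j => ?_⟩
  rw [hφ j]
  -- the sum is supported on the range of `e`
  have hsupp : ∀ l, l ∉ (Finset.univ : Finset S).map e → (if j = ι l then P l else 0) = 0 := by
    intro l hl
    have h : ¬ ∃ s : S, e s = l := by
      rintro ⟨s, rfl⟩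
      exact hl (Finset.mem_map_of_mem e (Finset.mem_univ s))
    simp only [P, if_neg h, ite_self]
  rw [← Finset.sum_subset (Finset.subset_univ ((Finset.univ : Finset S).map e))
    (fun l _ hl => hsupp l hl), Finset.sum_map]
  have hP : ∀ s : S, P (e s) = X (s : Fin n) := by
    intro s
    have h : ∃ s' : S, e s' = e s := ⟨s, rfl⟩
    simp only [P, if_pos h, hι s]
  simp_rw [hι, hP]
  by_cases hj : j ∈ S
  · rw [if_pos hj]
    rw [Finset.sum_eq_single (⟨j, hj⟩ : S)]
    · simp
    · rintro s - hs
      rw [if_neg]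
      intro h
      exact hs (Subtype.ext h.symm)
    · intro h; exact absurd (Finset.mem_univ _) h
  · rw [if_neg hj]
    refine Finset.sum_eq_zero fun s _ => ?_
    rw [if_neg]
    rintro rfl
    exact hj s.2

end Blocks

/-! ### The coordinate projection keeps the monomials supported inside `S` -/

section Projection

variable {K : Type*} [CommSemiring K] {n : ℕ}

/-- The coefficient of `x^μ` survives the projection `x_j ↦ [j ∈ S] x_j` when `var(x^μ) ⊆ S`.
[folklore] -/
private theorem coeff_aeval_proj (S : Finset (Fin n)) [DecidablePred (· ∈ S)] (f : MvPolynomial (Fin n) K)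
    (μ : Fin n →₀ ℕ) (hμ : μ.support ⊆ S) :
    coeff μ (aeval (fun j => if j ∈ S then (X j : MvPolynomial (Fin n) K) else 0) f) = coeff μ f := by
  classical
  set ψ : Fin n → MvPolynomial (Fin n) K := fun j => if j ∈ S then X j else 0 with hψ
  -- monomial by monomial
  have hmon : ∀ (ν : Fin n →₀ ℕ) (c : K), aeval ψ (monomial ν c) =
      if ν.support ⊆ S then monomial ν c else 0 := by
    intro ν c
    rw [aeval_monomial, MvPolynomial.algebraMap_eq]
    by_cases hν : ν.support ⊆ S
    · rw [if_pos hν, Finsupp.prod, monomial_eq, Finsupp.prod]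
      congr 1
      refine Finset.prod_congr rfl fun j hj => ?_
      rw [hψ]
      simp only [if_pos (hν hj)]
    · rw [if_neg hν]
      obtain ⟨j, hj, hjS⟩ := Finset.not_subset.1 hν
      rw [Finsupp.prod, ← Finset.mul_prod_erase _ _ hj]
      have : ψ j ^ ν j = 0 := by
        rw [hψ]
        simp only [if_neg hjS]
        exact zero_pow (Finsupp.mem_support_iff.1 hj)
      rw [this, zero_mul, mul_zero]
  conv_lhs => rw [f.as_sum, map_sum]
  rw [coeff_sum]
  simp_rw [hmon]
  rw [Finset.sum_eq_single μ]
  · rw [if_pos hμ, coeff_monomial, if_pos rfl]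
  · intro ν _ hνμ
    split_ifs
    · rw [coeff_monomial, if_neg hνμ]
    · exact coeff_zero _
  · intro hμf
    rw [if_pos hμ, coeff_monomial, if_pos rfl]
    exact (notMem_support_iff.1 hμf)

end Projection

/-! ### The support lemma: `k`-independent maps hit every monomial on `≤ k` variables -/

section Support

variable {K : Type*} [CommSemiring K] {n t : ℕ}

/-- **Support lemma.** If `f` has a nonzero coefficient at a monomial `x^μ` involving at most `k`
variables, then `f ∘ G ≠ 0` for every `k`-independent polynomial map `G`: project onto `var(x^μ)`.
(Not a numbered statement of the source: the `k`-fold coordinate case of the projection mechanism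
of Def 19 / Obs 3.1 / Lemma 3.10.) [cite: MediniShpilka2021, Def 19 and Obs 3.1 (arXiv p0017:L7-L9); Lemma 3.10 (p0018:L17-L40)] -/
theorem IsIndependent.bind₁_ne_zero_of_mem_support {k : ℕ}
    {G : Fin n → MvPolynomial (Fin k × (Fin t ⊕ Unit)) K} (hG : IsIndependent k G)
    {f : MvPolynomial (Fin n) K} {μ : Fin n →₀ ℕ} (hμ : μ ∈ f.support)
    (hk : μ.support.card ≤ k) : bind₁ G f ≠ 0 := by
  classical
  rcases Nat.eq_zero_or_pos n with rfl | hn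
  · -- no variables: `f` is a nonzero constant and so is `f ∘ G`
    intro h
    have hf : f = C (coeff 0 f) := by
      ext ν
      obtain rfl : ν = 0 := Subsingleton.elim ν 0
      rw [coeff_C, if_pos rfl]
    obtain rfl : μ = 0 := Subsingleton.elim μ 0
    have h1 : bind₁ G f = C (coeff 0 f) := by
      rw [hf, bind₁_C_right, coeff_C, if_pos rfl]
    rw [h1] at h
    exact (mem_support_iff.1 hμ) ((C_eq_zero).1 h)
  · obtain ⟨φ, hφ⟩ := hG.exists_aeval_eq_proj μ.support hk ⟨0, hn⟩
    intro h
    have hfun : (fun j => aeval φ (G j)) =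
        fun j => if j ∈ μ.support then (X j : MvPolynomial (Fin n) K) else 0 := funext hφ
    have h1 : aeval φ (bind₁ G f) =
        aeval (fun j => if j ∈ μ.support then (X j : MvPolynomial (Fin n) K) else 0) f := by
      rw [aeval_bind₁, hfun]
    have h2 := coeff_aeval_proj μ.support f μ subset_rfl
    rw [← h1, h, map_zero, coeff_zero] at h2
    exact (mem_support_iff.1 hμ) h2.symm

/-- **Degree form of the support lemma**: a nonzero polynomial of total degree `≤ k` is hit by every
`k`-independent polynomial map (every monomial of degree `≤ k` involves `≤ k` variables).
[cite: MediniShpilka2021, Def 19 and Obs 3.1 (arXiv p0017:L7-L9); Lemma 3.10 (p0018:L17-L40)] -/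
theorem IsIndependent.bind₁_ne_zero_of_totalDegree_le {k : ℕ}
    {G : Fin n → MvPolynomial (Fin k × (Fin t ⊕ Unit)) K} (hG : IsIndependent k G)
    {f : MvPolynomial (Fin n) K} (hf : f ≠ 0) (hd : f.totalDegree ≤ k) : bind₁ G f ≠ 0 := by
  classical
  obtain ⟨μ, hμ⟩ := Finset.nonempty_iff_ne_empty.2 (support_eq_empty.not.2 hf)
  refine hG.bind₁_ne_zero_of_mem_support hμ ?_
  calc μ.support.card = ∑ j ∈ μ.support, 1 := by simp
    _ ≤ ∑ j ∈ μ.support, μ j :=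
        Finset.sum_le_sum fun j hj => Nat.one_le_iff_ne_zero.2 (Finsupp.mem_support_iff.1 hj)
    _ = μ.degree := rfl
    _ ≤ f.totalDegree := le_totalDegree hμ
    _ ≤ k := hd

end Support

end MS2021

/-! ### Thm 35 for `max{Δ₁, Δ₂} ≤ 3` -/

section Thm35Slice

open MS2021

/-- **MS Thm 35, slice `max{Δ₁, Δ₂} ≤ 3`** (ANFs on at most `64` leaves), every field: if
`f₁ ∈ ANF_{Δ₁}^{GLaff_n(F)}`, `f₂ ∈ ANF_{Δ₂}^{GLaff_n(F)}`, `f₁ - f₂ ≠ 0` and `max{Δ₁, Δ₂} ≤ 3`, then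
`(f₁ - f₂) ∘ G ≠ 0` for every `(2 max{Δ₁, Δ₂} + 7)`-independent `G` (uniformity is not needed in
this range): `deg (f₁ - f₂) ≤ 2^{max Δ_i} ≤ 2 max Δ_i + 7`, and the support lemma applies. Route ≠
the printed §5.2 proof (disclosed in the module docstring).
[cite: MediniShpilka2021, Thm 35 (CCC p.19:13; = arXiv ‹pitSumOfRoanfThm› p0008.txt:L29-30)] -/
theorem MS2021_thm_35_of_max_le_three (K : Type) [Field K] (n Δ₁ Δ₂ c : ℕ)
    (hΔ : max Δ₁ Δ₂ ≤ 3) :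
    ∀ f₁ ∈ affOrbit n (anf K Δ₁), ∀ f₂ ∈ affOrbit n (anf K Δ₂), f₁ - f₂ ≠ 0 →
      ∀ G : Fin n → MvPolynomial (Fin (2 * max Δ₁ Δ₂ + 7) × (Fin c ⊕ Unit)) K,
        IsIndependent (2 * max Δ₁ Δ₂ + 7) G → IsUniform G → bind₁ G (f₁ - f₂) ≠ 0 := by
  intro f₁ hf₁ f₂ hf₂ hf G hG _
  refine hG.bind₁_ne_zero_of_totalDegree_le hf ?_
  -- `deg f_i ≤ 2^{Δ_i} ≤ 2^{max}`
  have hdeg : ∀ {Δ : ℕ} {f : MvPolynomial (Fin n) K}, f ∈ affOrbit n (anf K Δ) →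
      f.totalDegree ≤ 2 ^ Δ := by
    intro Δ f hf
    obtain ⟨h, A, b, -, rfl⟩ := hf
    exact (totalDegree_affSubst_le h A b _).trans (Cor36.totalDegree_anf_le Δ)
  have h1 : f₁.totalDegree ≤ 2 ^ max Δ₁ Δ₂ :=
    (hdeg hf₁).trans (Nat.pow_le_pow_right (by norm_num) (le_max_left _ _))
  have h2 : f₂.totalDegree ≤ 2 ^ max Δ₁ Δ₂ :=
    (hdeg hf₂).trans (Nat.pow_le_pow_right (by norm_num) (le_max_right _ _))
  have hpow : 2 ^ max Δ₁ Δ₂ ≤ 2 * max Δ₁ Δ₂ + 7 := by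
    generalize max Δ₁ Δ₂ = m at hΔ ⊢
    interval_cases m <;> norm_num
  calc (f₁ - f₂).totalDegree ≤ max f₁.totalDegree f₂.totalDegree := totalDegree_sub _ _
    _ ≤ 2 ^ max Δ₁ Δ₂ := max_le h1 h2
    _ ≤ 2 * max Δ₁ Δ₂ + 7 := hpow

end Thm35Slice

end Literature.Computability.AlgebraicComplexity

end
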